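import Mathlib
import HarnessLib
import Summits.CriticalPhenomena.CardyFormulaZ2.Theses.CardySelfDualSegment
import Literature.Probability.Percolation.CornerPercolation
import Literature.Barriers.CriticalPhenomena.EmbeddingModulusUniquenessProofs
import Literature.Probability.RandomPlanarGeometry.ConformalRectangleProofs
import Literature.Probability.RandomPlanarGeometry.CardyFunction
import Summits.CriticalPhenomena.CardyFormulaZ2.Theorems.CardySelfDualSegmentSegmentOpenStubJetConv
import Summits.CriticalPhenomena.CardyFormulaZ2.Theorems.CardySelfDualSegmentUniformMarginalityWildFromRectilinear

/-!
# Crux `SegmentOpen` (stmt-CriticalPhenomena-5471) — strategist line `confinement-rigidity`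
# (ANALYTICITY-FREE contingency line; published, NOT registered — the live skeleton `Lines/Sketch.lean` is untouched)

Crux-strategist `cstrat-stmt-CriticalPhenomena-5471-s2` (planner), 2026-08-17.  Spine: crux idea
`cardy-manifold-asymptotic-phase` (ideator 1, card A), typed in the CROSSING-PROBABILITY CHART (no noise space).

WHY THIS FILE EXISTS.  The live line `Sketch` (reshape 8: S4wR / JCR / JIR) bets on ANALYTICITY of the
crossing polynomials in the freeing density `t`, uniformly in the mesh.  Its order-1 content is the convergence
(JC, k = 1) resp. boundedness (S4wR ⊢ RussoBound) of the signed pivotal sum `a₁(δ, R')` — the lead's STUCK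
goal, under Monte-Carlo test (log test).  If `a₁ ∝ log δ⁻¹`, all three stubs of `Sketch` are FALSE, but the
crux, its hypothesis UM and the route's Target may all still hold (non-analytic modulus motion
`θ(t) − θ(0) ~ t log(1/t)`): the log test discriminates the LINE, not the crux.  This file is the only
reformulation found by the strategist census (`STRATEGY-CENSUS.md`) that uses no analyticity, no jets and no
rate at the Smirnov point: OPENNESS of the good set from (R3) ISOLATION of the sheared-Cardy family among the
subsequential crossing limits of the corner models that are `ε₀`-confined near an actual good modulus, and
(R4) ASYMPTOTIC PHASE (uniqueness of the subsequential modulus), composed with the crux hypothesis UM (used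
non-trivially: it is the CONFINEMENT, cf. `Disproof.not_isOpen_goodSet_of_marginal_family`) and the landed
rectilinear-to-wild transport (W) `HeatFlow.cardyLimit_of_rectilinear` (p137344).

HONEST STATUS.  `stub_isolation` is a law-level rigidity statement with NO known attack (the crux's own
"why it might fail"); it is weaker than the Target (implied by it), not equivalent to the crux modulo the
other stub, and does not contain the stuck goal `a₁(δ)`.  Adopt this line only if the log test kills `Sketch`.

`lean check`: rc 0 expected with sorries ONLY in `stub_isolation`, `stub_asymptoticPhase`; the composition
`segmentOpen_of_rigidity` is sorry-free.
-/

noncomputable section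

namespace Summit.CriticalPhenomena.CardyFormulaZ2.Cruxes.SegmentOpen.ConfinementRigidity

open Literature.Probability Literature.Barriers.CriticalPhenomena
open Literature.Probability.RandomPlanarGeometry (ConformalRectangle ConformalEquiv MarkedDomain
  cardyFunction crossRatio)
open Filter Set Topology MeasureTheory
open UpperHalfPlane (upperHalfPlaneSet)

/-! ## Stubs (tree vocabulary only) -/

/-- (R3) ISOLATION of the sheared-Cardy family near an actual good modulus (research, XL; no known attack).
For every modulus `α₀ ∈ ℍ` that IS the sheared-Cardy modulus of some corner model `M_{t₀}`, there are a
tolerance `ε₀ > 0` and a FINITE test family `F` of conformal rectangles such that: whenever the crude crossing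
probabilities of a corner model `M_t` (ANY `t`) are eventually-in-the-mesh `ε₀`-close to the `α₀`-sheared Cardy
values on `F` ("confinement"), then along every mesh sequence `δ_k → 0⁺` there is a subsequence on which the
crossing probabilities of ALL rectilinear conformal rectangles converge to the `α`-sheared Cardy values for ONE
modulus `α ∈ ℍ` (depending on the subsequence).  Dynamics reading: no dilation-invariant compact set of
corner-model subsequential limits near the sheared-CLE₆ manifold lies off it.  Implied by the route's Target;
does not imply it; t-free in content (the hypothesis is observable closeness, not parameter closeness). -/
theorem stub_isolation :
    ∀ α₀ : ℂ, 0 < α₀.im →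
      (∃ t₀ : unitInterval, ∀ (R R' : ConformalRectangle)
          (φ : ConformalEquiv upperHalfPlaneSet R.carrier) (x : Fin 4 → ℝ),
          R.carrier = moduliShear α₀ '' R'.carrier → (∀ i, R.pt i = moduliShear α₀ (R'.pt i)) →
          R.IsUniformizing φ x →
          Tendsto (Percolation.cornerCrossingProb t₀ R') (𝓝[>] 0) (𝓝 (cardyFunction (crossRatio x)))) →
      ∃ ε₀ > 0, ∃ F : Finset ConformalRectangle, ∀ t : unitInterval,
        (∀ R' ∈ F, ∀ (R : ConformalRectangle) (φ : ConformalEquiv upperHalfPlaneSet R.carrier)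
            (x : Fin 4 → ℝ),
            R.carrier = moduliShear α₀ '' R'.carrier → (∀ i, R.pt i = moduliShear α₀ (R'.pt i)) →
            R.IsUniformizing φ x →
            ∀ᶠ δ in 𝓝[>] (0 : ℝ),
              |Percolation.cornerCrossingProb t R' δ - cardyFunction (crossRatio x)| < ε₀) →
        ∀ δs : ℕ → ℝ, (∀ k, 0 < δs k) → Tendsto δs atTop (𝓝 0) →
          ∃ ψ : ℕ → ℕ, StrictMono ψ ∧ ∃ α : ℂ, 0 < α.im ∧
            ∀ R' : ConformalRectangle,
              (∃ S : Finset (ℂ × ℂ), (∀ p ∈ S, p.1.re = p.2.re ∨ p.1.im = p.2.im) ∧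
                frontier R'.carrier ⊆ ⋃ p ∈ S, segment ℝ p.1 p.2) →
              ∀ (R : ConformalRectangle) (φ : ConformalEquiv upperHalfPlaneSet R.carrier) (x : Fin 4 → ℝ),
                R.carrier = moduliShear α '' R'.carrier → (∀ i, R.pt i = moduliShear α (R'.pt i)) →
                R.IsUniformizing φ x →
                Tendsto (fun k => Percolation.cornerCrossingProb t R' (δs (ψ k))) atTop
                  (𝓝 (cardyFunction (crossRatio x))) := by
  sorry

/-- (R4) ASYMPTOTIC PHASE = uniqueness of the subsequential modulus (research, L–XL).  If along every mesh
sequence `δ_k → 0⁺` some subsequence of the crude `M_t`-crossing probabilities of all rectilinear conformal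
rectangles converges to the `α`-sheared Cardy values for SOME modulus `α ∈ ℍ` (possibly depending on the
subsequence), then ONE modulus serves and the full limits `δ → 0⁺` exist: the modulus cannot drift along the
arc of sheared-Cardy fixed points.  Content: no slow oscillation of (e.g.) the diamond crossing in `log δ`
(summable transverse attraction ⇒ asymptotic phase); the rest is the subsequence principle.  Implied by the
Target; independent of (R3). -/
theorem stub_asymptoticPhase :
    ∀ t : unitInterval,
      (∀ δs : ℕ → ℝ, (∀ k, 0 < δs k) → Tendsto δs atTop (𝓝 0) →
          ∃ ψ : ℕ → ℕ, StrictMono ψ ∧ ∃ α : ℂ, 0 < α.im ∧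
            ∀ R' : ConformalRectangle,
              (∃ S : Finset (ℂ × ℂ), (∀ p ∈ S, p.1.re = p.2.re ∨ p.1.im = p.2.im) ∧
                frontier R'.carrier ⊆ ⋃ p ∈ S, segment ℝ p.1 p.2) →
              ∀ (R : ConformalRectangle) (φ : ConformalEquiv upperHalfPlaneSet R.carrier) (x : Fin 4 → ℝ),
                R.carrier = moduliShear α '' R'.carrier → (∀ i, R.pt i = moduliShear α (R'.pt i)) →
                R.IsUniformizing φ x →
                Tendsto (fun k => Percolation.cornerCrossingProb t R' (δs (ψ k))) atTop
                  (𝓝 (cardyFunction (crossRatio x)))) →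
      ∃ α : ℂ, 0 < α.im ∧
        ∀ R' : ConformalRectangle,
          (∃ S : Finset (ℂ × ℂ), (∀ p ∈ S, p.1.re = p.2.re ∨ p.1.im = p.2.im) ∧
            frontier R'.carrier ⊆ ⋃ p ∈ S, segment ℝ p.1 p.2) →
          ∀ (R : ConformalRectangle) (φ : ConformalEquiv upperHalfPlaneSet R.carrier) (x : Fin 4 → ℝ),
            R.carrier = moduliShear α '' R'.carrier → (∀ i, R.pt i = moduliShear α (R'.pt i)) →
            R.IsUniformizing φ x →
            Tendsto (Percolation.cornerCrossingProb t R') (𝓝[>] 0)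
              (𝓝 (cardyFunction (crossRatio x))) := by
  sorry

/-! ## Vocabulary for the glue (reducible abbreviations of the route's `let` blocks; as in `Lines/Sketch.lean`) -/

/-- `CardyMod t α` of the route, over `Percolation.cornerCrossingProb` (= the route's `P` syntactically). -/
abbrev CardyModAt (t : unitInterval) (α : ℂ) : Prop :=
  ∀ (R R' : ConformalRectangle)
    (φ : ConformalEquiv upperHalfPlaneSet R.carrier) (x : Fin 4 → ℝ),
    R.carrier = moduliShear α '' R'.carrier → (∀ i, R.pt i = moduliShear α (R'.pt i)) →
    R.IsUniformizing φ x →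
    Tendsto (Percolation.cornerCrossingProb t R') (𝓝[>] 0) (𝓝 (cardyFunction (crossRatio x)))

/-- The route's good set `G = {t | ∃ α, 0 < Im α ∧ CardyMod t α}`. -/
abbrev goodSet : Set unitInterval := {t | ∃ α : ℂ, 0 < α.im ∧ CardyModAt t α}

/-- The route's `UniformMarginality` body (the hypothesis of `SegmentOpen`; LOAD-BEARING in this line: it is
the confinement). -/
abbrev UM : Prop :=
  ∀ (t₀ : unitInterval) (R : ConformalRectangle) (ε : ℝ), 0 < ε → ∃ η > 0, ∀ t : unitInterval,
    dist t t₀ < η → ∀ δ : ℝ, 0 < δ →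
      |Percolation.cornerCrossingProb t R δ - Percolation.cornerCrossingProb t₀ R δ| < ε

/-- The rectilinearity side condition of (W), as a predicate. -/
abbrev IsRectilinear (R' : ConformalRectangle) : Prop :=
  ∃ S : Finset (ℂ × ℂ), (∀ p ∈ S, p.1.re = p.2.re ∨ p.1.im = p.2.im) ∧
    frontier R'.carrier ⊆ ⋃ p ∈ S, segment ℝ p.1 p.2

/-- Sheared-Cardy limits of `M_t` along a mesh SEQUENCE, on all rectilinear test domains, modulus `α`. -/
abbrev SeqCardyRect (t : unitInterval) (α : ℂ) (δs : ℕ → ℝ) : Prop :=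
  ∀ R' : ConformalRectangle, IsRectilinear R' →
    ∀ (R : ConformalRectangle) (φ : ConformalEquiv upperHalfPlaneSet R.carrier) (x : Fin 4 → ℝ),
      R.carrier = moduliShear α '' R'.carrier → (∀ i, R.pt i = moduliShear α (R'.pt i)) →
      R.IsUniformizing φ x →
      Tendsto (fun k => Percolation.cornerCrossingProb t R' (δs k)) atTop (𝓝 (cardyFunction (crossRatio x)))

/-- Sheared-Cardy limits of `M_t` as `δ → 0⁺`, on all rectilinear test domains, modulus `α`
(`CardyModAt t α` restricted to rectilinear `R'`; the hypothesis of (W)). -/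
abbrev CardyModRect (t : unitInterval) (α : ℂ) : Prop :=
  ∀ R' : ConformalRectangle, IsRectilinear R' →
    ∀ (R : ConformalRectangle) (φ : ConformalEquiv upperHalfPlaneSet R.carrier) (x : Fin 4 → ℝ),
      R.carrier = moduliShear α '' R'.carrier → (∀ i, R.pt i = moduliShear α (R'.pt i)) →
      R.IsUniformizing φ x →
      Tendsto (Percolation.cornerCrossingProb t R') (𝓝[>] 0) (𝓝 (cardyFunction (crossRatio x)))

/-- `ε`-confinement of `M_t` near the `α₀`-sheared Cardy values on the test family `F`. -/
abbrev Confined (t : unitInterval) (α₀ : ℂ) (ε : ℝ) (F : Finset ConformalRectangle) : Prop :=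
  ∀ R' ∈ F, ∀ (R : ConformalRectangle) (φ : ConformalEquiv upperHalfPlaneSet R.carrier) (x : Fin 4 → ℝ),
    R.carrier = moduliShear α₀ '' R'.carrier → (∀ i, R.pt i = moduliShear α₀ (R'.pt i)) →
    R.IsUniformizing φ x →
    ∀ᶠ δ in 𝓝[>] (0 : ℝ), |Percolation.cornerCrossingProb t R' δ - cardyFunction (crossRatio x)| < ε

/-- (R3) as a Prop. -/
abbrev Isolation : Prop :=
  ∀ α₀ : ℂ, 0 < α₀.im → (∃ t₀ : unitInterval, CardyModAt t₀ α₀) →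
    ∃ ε₀ > 0, ∃ F : Finset ConformalRectangle, ∀ t : unitInterval, Confined t α₀ ε₀ F →
      ∀ δs : ℕ → ℝ, (∀ k, 0 < δs k) → Tendsto δs atTop (𝓝 0) →
        ∃ ψ : ℕ → ℕ, StrictMono ψ ∧ ∃ α : ℂ, 0 < α.im ∧ SeqCardyRect t α (δs ∘ ψ)

/-- (R4) as a Prop. -/
abbrev AsymptoticPhase : Prop :=
  ∀ t : unitInterval,
    (∀ δs : ℕ → ℝ, (∀ k, 0 < δs k) → Tendsto δs atTop (𝓝 0) →
        ∃ ψ : ℕ → ℕ, StrictMono ψ ∧ ∃ α : ℂ, 0 < α.im ∧ SeqCardyRect t α (δs ∘ ψ)) →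
    ∃ α : ℂ, 0 < α.im ∧ CardyModRect t α

/-- The stubs are literally (R3), (R4). -/
theorem isolation_of_stub : Isolation := stub_isolation

theorem asymptoticPhase_of_stub : AsymptoticPhase := stub_asymptoticPhase

/-! ## Glue (proved) -/

/-- The route's `SegmentOpen` unfolds (zeta/delta) to `UM → IsOpen goodSet`. -/
theorem segmentOpen_iff :
    Summit.CriticalPhenomena.CardyFormulaZ2.Theses.CardySelfDualSegment.SegmentOpen ↔
      (UM → IsOpen goodSet) := Iff.rfl

/-- CONFINEMENT FROM UM (soft): near a good point `t₀` (modulus `α₀`), every corner model `M_t` is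
`ε`-confined near the `α₀`-sheared Cardy values on any finite test family — eventually in `t`. -/
theorem eventually_confined (hUM : UM) {t₀ : unitInterval} {α₀ : ℂ} (hC₀ : CardyModAt t₀ α₀)
    {ε : ℝ} (hε : 0 < ε) (F : Finset ConformalRectangle) :
    ∀ᶠ t in 𝓝 t₀, Confined t α₀ ε F := by
  have hnear : ∀ᶠ t in 𝓝 t₀, ∀ R' ∈ F, ∀ δ : ℝ, 0 < δ →
      |Percolation.cornerCrossingProb t R' δ - Percolation.cornerCrossingProb t₀ R' δ| < ε / 2 := by
    rw [eventually_all_finset]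
    intro R' _
    obtain ⟨η, hη, h⟩ := hUM t₀ R' (ε / 2) (by positivity)
    exact Metric.eventually_nhds_iff.2 ⟨η, hη, fun t ht => h t ht⟩
  filter_upwards [hnear] with t ht
  intro R' hR' R φ x hc hp hu
  have h₀ : ∀ᶠ δ in 𝓝[>] (0 : ℝ),
      dist (Percolation.cornerCrossingProb t₀ R' δ) (cardyFunction (crossRatio x)) < ε / 2 :=
    Metric.tendsto_nhds.1 (hC₀ R R' φ x hc hp hu) (ε / 2) (by positivity)
  have hpos : ∀ᶠ δ in 𝓝[>] (0 : ℝ), δ ∈ Ioi (0 : ℝ) := eventually_mem_nhdsWithin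
  filter_upwards [h₀, hpos] with δ hδ hδpos
  have h1 := ht R' hR' δ hδpos
  rw [Real.dist_eq] at hδ
  calc |Percolation.cornerCrossingProb t R' δ - cardyFunction (crossRatio x)|
      = |(Percolation.cornerCrossingProb t R' δ - Percolation.cornerCrossingProb t₀ R' δ) +
          (Percolation.cornerCrossingProb t₀ R' δ - cardyFunction (crossRatio x))| := by ring_nf
    _ ≤ |Percolation.cornerCrossingProb t R' δ - Percolation.cornerCrossingProb t₀ R' δ| +
          |Percolation.cornerCrossingProb t₀ R' δ - cardyFunction (crossRatio x)| := abs_add_le _ _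
    _ < ε / 2 + ε / 2 := add_lt_add h1 hδ
    _ = ε := by ring

/-- (W) in this file's vocabulary: rectilinear sheared-Cardy limits give `CardyMod t α` for every conformal
rectangle (landed `HeatFlow.cardyLimit_of_rectilinear`, p137344). -/
theorem cardyModAt_of_rect {t : unitInterval} {α : ℂ} (hα : 0 < α.im) (h : CardyModRect t α) :
    CardyModAt t α :=
  fun R R' φ x hc hp hu =>
    Summit.CriticalPhenomena.CardyFormulaZ2.Cruxes.UniformMarginality.HeatFlow.cardyLimit_of_rectilinear
      t α hα (fun R R' φ x hrect hc hp hu => h R' hrect R φ x hc hp hu) R R' φ x hc hp hu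

/-- RIGIDITY ⇒ good points are interior points: `Isolation`, `AsymptoticPhase` and UM make every point near
a good point good. -/
theorem goodSet_mem_nhds (hI : Isolation) (hP : AsymptoticPhase) (hUM : UM) {t₀ : unitInterval}
    (ht₀ : t₀ ∈ goodSet) : goodSet ∈ 𝓝 t₀ := by
  obtain ⟨α₀, hα₀, hC₀⟩ := ht₀
  obtain ⟨ε₀, hε₀, F, hF⟩ := hI α₀ hα₀ ⟨t₀, hC₀⟩
  filter_upwards [eventually_confined hUM hC₀ hε₀ F] with t ht
  obtain ⟨α, hα, hrect⟩ := hP t (hF t ht)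
  exact ⟨α, hα, cardyModAt_of_rect hα hrect⟩

/-- RIGIDITY ⇒ the good set is open (given UM). -/
theorem isOpen_goodSet (hI : Isolation) (hP : AsymptoticPhase) (hUM : UM) : IsOpen goodSet :=
  isOpen_iff_mem_nhds.2 fun _ ht => goodSet_mem_nhds hI hP hUM ht

/-- COMPOSITION: (R3) → (R4) → the crux, BY NAME. -/
theorem segmentOpen_of_rigidity (hI : Isolation) (hP : AsymptoticPhase) :
    Summit.CriticalPhenomena.CardyFormulaZ2.Theses.CardySelfDualSegment.SegmentOpen := by
  rw [segmentOpen_iff]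
  exact isOpen_goodSet hI hP

/-- The crux from the two stubs. -/
theorem SegmentOpen_of :
    Summit.CriticalPhenomena.CardyFormulaZ2.Theses.CardySelfDualSegment.SegmentOpen :=
  segmentOpen_of_rigidity isolation_of_stub asymptoticPhase_of_stub

end Summit.CriticalPhenomena.CardyFormulaZ2.Cruxes.SegmentOpen.ConfinementRigidity

end
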